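import Literature.NumberTheory.EllipticCurves.Serre1967.NoStableDivisibleLineLocalProofs
import Literature.NumberTheory.EllipticCurves.Serre1967.PotentiallySupersingularNoStableLine
import Literature.NumberTheory.EllipticCurves.DecompositionAbsIntegersExtensionProofs
import Literature.NumberTheory.EllipticCurves.PotentialGoodReductionOddProofs
import Literature.NumberTheory.EllipticCurves.OpenImageMazurInertiaThreeProofs
import Literature.NumberTheory.EllipticCurves.TateModuleBaseChange
import Literature.NumberTheory.EllipticCurves.GeomPointsGaloisModule
import Literature.NumberTheory.EllipticCurves.CanonicalPAdicHeightRestrictionProofs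
import Literature.NumberTheory.GaloisRepresentations.DecompositionGroupOfCompletion
import HarnessLib

/-!
# Serre 1967, §5 Prop. 8 / Th. 4 (LINE case): no `D_𝔭`-stable `p`-divisible line on `E[p^∞]` at a
# place of potentially supersingular reduction — discharge of
# `noStableDivisibleLine_of_potentiallySupersingular` (proofs only)

`Proofs`-style file (THEOREMS ONLY), topic `NumberTheory/EllipticCurves`, paper group `Serre1967`.
We prove the tree's named fact `Serre1967.noStableDivisibleLine_of_potentiallySupersingular`
(`PotentiallySupersingularNoStableLine.lean`). Given `W/ℚ`, a prime `p` with `ord_p j(W) ≥ 0`,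
potentially supersingular reduction at `p` (hypothesis (2) of the fact), a number field `K`, a place
`𝔭 ∣ p` and a `D_𝔭`-stable, `p`-divisible subgroup `N ≤ E(K̄)[p^∞]` with `#N[p] ≤ p`:

1. `|j|_𝔭 ≤ 1` (`valuation_ratCast_le_one_of_padicValRat_nonneg`), so `E_K` acquires good reduction
   above `𝔭` over a finite extension `F/K` (`p` odd: adjoin `E[4]`,
   `exists_isGalois_hasGoodReductionAt_baseChange_of_valuation_j_le_one_of_notMem_two`; `p = 2`:
   adjoin `E[3]`, `hasGoodReductionAt_baseChange_of_forall_smul_geomTorsion_three_eq`); at a place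
   `w ∣ 𝔭` of `F` the reduction is supersingular by hypothesis (2) (`(E_K)_F = E_F`).
2. Transport: `N ↦ ι₂_* ι₁_* (τ • N) ≤ E(\bar{F_w})` along the chosen embeddings
   `K̄ → F̄ → \bar{F_w}` (`geomPointsMapOfEmb`, `pointsMapOfEmb`, both injective and equivariant
   along the restrictions `Γ_{F_w} → Γ_F → Γ_K`), after moving by `τ ∈ Γ_K` so that the
   decomposition group of the prime of `\bar ℤ_K` cut out by `F̄ → \bar{F_w}`
   (`exists_primesAbove_decompositionSubgroup_le_comap`, `decompositionSubgroup_adicCompletionPrime_eq_range`,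
   transitivity `exists_smul_eq_of_mem_primesAbove_holds`) is carried into `D_𝔭 = decomp 𝔭`; the
   image is `Γ_{F_w}`-stable (`eq_bot_of_stable_of_injective`, pure algebra).
3. Conclude by the local theorem at a good supersingular place
   (`Serre1967.eq_bot_of_stable_localPoints`, file `NoStableDivisibleLineLocalProofs`).

* `Serre1967.eq_bot_of_stable_of_injective` — transport along an injective additive map,
  equivariant along a map of monoids `φ : D' → D`;
* (private) `valuation_ratCast_le_one_of_padicValRat_nonneg` — `ord_ℓ q ≥ 0 ⇒ |q|_v ≤ 1` for `v ∣ ℓ`;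
* `Serre1967.noStableDivisibleLine_of_potentiallySupersingular_holds` — the named fact.

## References

* J.-P. Serre, Proc. Conf. Local Fields (Driebergen 1966), Springer 1967, §5 Prop. 8, Lemme 3, Th. 4.
  [Serre1967GroupesPDivisibles]
* J.-P. Serre, J. Tate, Ann. of Math. 88 (1968), §2 Cor. 3 (potential good reduction). [SerreTate1968]
* J. Neukirch, *Algebraic Number Theory*, Ch. I §9 (9.1), (9.4). [NeukirchANT1999]
-/

noncomputable section

open scoped Classical NumberField Pointwise

universe u

namespace Literature.NumberTheory.EllipticCurves

open WeierstrassCurve Field NumberField IsDedekindDomain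

/-! ### `ord_ℓ q ≥ 0 ⇒ |q|_v ≤ 1` -/

section Places

variable {K : Type*} [Field K] [NumberField K] {v : HeightOneSpectrum (𝓞 K)}

/-- **A rational number with `ord_ℓ q ≥ 0` is `v`-integral at every place `v` above `ℓ`**:
`|q|_v ≤ 1` (write `q = num/den` in lowest terms; `ord_ℓ q ≥ 0` forces `ℓ ∤ den`, so `den` is a
`v`-adic unit and `num ∈ 𝓞 K`); private helper. [folklore] -/
private theorem valuation_ratCast_le_one_of_padicValRat_nonneg {ℓ : ℕ} (hℓ : ℓ.Prime)
    (hℓv : (ℓ : 𝓞 K) ∈ v.asIdeal) {q : ℚ} (hq : 0 ≤ padicValRat ℓ q) :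
    v.valuation K (q : K) ≤ 1 := by
  by_cases hq0 : q = 0
  · simp [hq0]
  haveI := Fact.mk hℓ
  have hden : ¬ ℓ ∣ q.den := by
    intro hd
    have h1 : padicValInt ℓ q.num = 0 := by
      rw [padicValInt, padicValNat.eq_zero_of_not_dvd]
      exact fun h => not_dvd_num_of_dvd_den hℓ hd (Int.natCast_dvd.mpr h)
    have h2 : 1 ≤ padicValNat ℓ q.den := one_le_padicValNat_of_dvd q.den_nz hd
    have h3 : padicValRat ℓ q = -(padicValNat ℓ q.den : ℤ) := by
      rw [padicValRat, h1]; simp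
    omega
  have hden' : ¬ (ℓ : ℤ) ∣ (q.den : ℤ) := fun h => hden (Int.natCast_dvd_natCast.mp h)
  rw [Rat.cast_def, map_div₀, ← Int.cast_natCast,
    valuation_intCast_eq_one_of_not_dvd hℓ hℓv hden', div_one]
  have e : ((q.num : ℤ) : K) = algebraMap (𝓞 K) K (q.num : 𝓞 K) := by simp
  rw [e]
  exact HeightOneSpectrum.valuation_le_one v _

end Places

namespace Serre1967

open Literature.NumberTheory.GaloisRepresentations

/-! ### Transport along an injective equivariant additive map -/

section Transport

variable {G G' : Type*} [AddCommGroup G] [AddCommGroup G'] {D D' : Type*} [Monoid D] [Monoid D']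
  [DistribMulAction D G] [DistribMulAction D' G'] (p : ℕ)

/-- Transport of «no stable `p`-divisible line» along an INJECTIVE additive map `f : G →+ G'` that is
equivariant along a map `φ : D' → D` (`f (φ γ • x) = γ • f x`): if every `D'`-stable, `p`-primary,
`p`-divisible subgroup of `G'` with finite `p`-torsion of size `≤ p` is trivial, then so is every
subgroup of `G` stable under `φ(D')` with the same properties (used with `f` the embedding
`E(K̄) → E(\bar{F_w})` and `φ` the restriction `Γ_{F_w} → Γ_K`, Serre §5: the statement is local
at the decomposition group). [cite: Serre1967GroupesPDivisibles, §5 Prop. 8 (proof)] -/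
theorem eq_bot_of_stable_of_injective (f : G →+ G') (hf : Function.Injective f) (φ : D' → D)
    (hφ : ∀ (γ : D') (x : G), f (φ γ • x) = γ • f x)
    (hG' : ∀ N' : AddSubgroup G', (∀ γ : D', ∀ c ∈ N', γ • c ∈ N') →
      (∀ c ∈ N', ∃ k : ℕ, p ^ k • c = 0) → (∀ c ∈ N', ∃ c' ∈ N', p • c' = c) →
      {c : G' | c ∈ N' ∧ p • c = 0}.Finite → Set.ncard {c : G' | c ∈ N' ∧ p • c = 0} ≤ p → N' = ⊥)
    (N : AddSubgroup G) (hstab : ∀ γ : D', ∀ c ∈ N, φ γ • c ∈ N)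
    (htors : ∀ c ∈ N, ∃ k : ℕ, p ^ k • c = 0) (hdiv : ∀ c ∈ N, ∃ c' ∈ N, p • c' = c)
    (hfin : {c : G | c ∈ N ∧ p • c = 0}.Finite) (hcard : Set.ncard {c : G | c ∈ N ∧ p • c = 0} ≤ p) :
    N = ⊥ := by
  set N' : AddSubgroup G' := N.map f with hN'
  have hmem : ∀ {c' : G'}, c' ∈ N' ↔ ∃ c ∈ N, f c = c' := fun {c'} => by
    rw [hN', AddSubgroup.mem_map]
  have hset : {c : G' | c ∈ N' ∧ p • c = 0} = f '' {c : G | c ∈ N ∧ p • c = 0} := by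
    ext c'
    constructor
    · rintro ⟨hc', hp0⟩
      obtain ⟨c, hc, rfl⟩ := hmem.mp hc'
      refine ⟨c, ⟨hc, hf ?_⟩, rfl⟩
      rw [map_nsmul, map_zero]; exact hp0
    · rintro ⟨c, ⟨hc, hp0⟩, rfl⟩
      exact ⟨hmem.mpr ⟨c, hc, rfl⟩, by rw [← map_nsmul, hp0, map_zero]⟩
  have hN'bot : N' = ⊥ := by
    refine hG' N' ?_ ?_ ?_ ?_ ?_
    · intro γ c' hc'
      obtain ⟨c, hc, rfl⟩ := hmem.mp hc'
      rw [← hφ]; exact hmem.mpr ⟨φ γ • c, hstab γ c hc, rfl⟩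
    · intro c' hc'
      obtain ⟨c, hc, rfl⟩ := hmem.mp hc'
      obtain ⟨k, hk⟩ := htors c hc
      exact ⟨k, by rw [← map_nsmul, hk, map_zero]⟩
    · intro c' hc'
      obtain ⟨c, hc, rfl⟩ := hmem.mp hc'
      obtain ⟨c₁, hc₁, hpc₁⟩ := hdiv c hc
      exact ⟨f c₁, hmem.mpr ⟨c₁, hc₁, rfl⟩, by rw [← map_nsmul, hpc₁]⟩
    · rw [hset]; exact hfin.image _
    · rw [hset, Set.ncard_image_of_injective _ hf]; exact hcard
  rw [eq_bot_iff]
  intro c hc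
  have : f c ∈ N' := hmem.mpr ⟨c, hc, rfl⟩
  rw [hN'bot, AddSubgroup.mem_bot] at this
  rw [AddSubgroup.mem_bot]
  exact hf (by rw [this, map_zero])

end Transport

/-! ### The named fact -/

/-- **Serre 1967, §5 Prop. 8 / Th. 4, LINE case (discharge of
`noStableDivisibleLine_of_potentiallySupersingular`).** Let `W/ℚ` be an elliptic curve and `p` a
prime with `ord_p j(W) ≥ 0` such that `W` has supersingular reduction at every place of good
reduction above `p` of every number field. Then for every number field `K`, place `𝔭 ∣ p` and
`D_𝔭`-stable subgroup `N ≤ E(K̄)[p^∞]` that is `p`-divisible inside itself with `#N[p] ≤ p`, one has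
`N = 0`: there is no Galois-stable copy of `ℚ_p/ℤ_p` («le groupe d'inertie opère de façon
irréductible … E_𝔭 est un O_𝔭-module de hauteur 2», so no stable line). Proof: potential good
(hence supersingular) reduction over a finite `F/K` at `w ∣ 𝔭`, transport of `N` into
`E(\bar{F_w})` along equivariant embeddings, and the local theorem `eq_bot_of_stable_localPoints`.
[cite: Serre1967GroupesPDivisibles, §5 Prop. 8 and Th. 4] -/
theorem noStableDivisibleLine_of_potentiallySupersingular_holds :
    noStableDivisibleLine_of_potentiallySupersingular := by
  intro W _ p _ hj hssF K _ _ 𝔭 hp𝔭 N hNstab hNdiv hNcard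
  have hp : p.Prime := Fact.out
  haveI : (W.baseChange K).IsElliptic := inferInstanceAs (W.map (algebraMap ℚ K)).IsElliptic
  -- (1) `|j|_𝔭 ≤ 1`
  have hjK : 𝔭.valuation K (W.baseChange K).j ≤ 1 := by
    rw [show (W.baseChange K).j = (W.j : K) by
      simp only [WeierstrassCurve.baseChange, WeierstrassCurve.map_j, eq_ratCast]]
    exact valuation_ratCast_le_one_of_padicValRat_nonneg hp hp𝔭 hj
  -- (2) potential good reduction above `𝔭` over a finite `F/K`
  obtain ⟨F, hFfin, hFnf, hgoodF⟩ : ∃ (F : IntermediateField K (AlgebraicClosure K))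
      (_ : FiniteDimensional K F) (_ : NumberField F), ∀ w : HeightOneSpectrum (𝓞 F),
        w.asIdeal.under (𝓞 K) = 𝔭.asIdeal → ((W.baseChange K).baseChange F).HasGoodReductionAt w := by
    by_cases hp2 : p = 2
    · subst hp2
      have h3 : (3 : 𝓞 K) ∉ 𝔭.asIdeal := by
        intro h3
        apply 𝔭.isPrime.ne_top
        rw [Ideal.eq_top_iff_one, show (1 : 𝓞 K) = 3 - 2 by norm_num]
        exact 𝔭.asIdeal.sub_mem h3 (by exact_mod_cast hp𝔭)
      obtain ⟨F, hfin, hgal, hF⟩ :=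
        (W.baseChange K).exists_isGalois_forall_smul_geomTorsion_eq (m := 3) three_ne_zero
      haveI := hfin
      haveI := hgal
      haveI : NumberField F := NumberField.of_module_finite K F
      exact ⟨F, hfin, inferInstance, fun w hw =>
        (W.baseChange K).hasGoodReductionAt_baseChange_of_forall_smul_geomTorsion_three_eq F hF h3
          hjK hw⟩
    · have h2 : (2 : 𝓞 K) ∉ 𝔭.asIdeal := by
        intro h2
        apply 𝔭.isPrime.ne_top
        rw [Ideal.eq_top_iff_one]
        obtain ⟨k, hk⟩ := hp.odd_of_ne_two hp2
        have h1 : (1 : 𝓞 K) = (p : 𝓞 K) - 2 * (k : 𝓞 K) := by rw [hk]; push_cast; ring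
        rw [h1]
        exact 𝔭.asIdeal.sub_mem (by exact_mod_cast hp𝔭) (𝔭.asIdeal.mul_mem_right _ h2)
      obtain ⟨F, hfin, -, hnf, hF⟩ :=
        (W.baseChange K).exists_isGalois_hasGoodReductionAt_baseChange_of_valuation_j_le_one_of_notMem_two
          𝔭 hjK h2
      exact ⟨F, hfin, hnf, hF⟩
  haveI := hFfin
  haveI := hFnf
  -- (3) a place `w ∣ 𝔭` of `F`; `p ∈ w`; supersingular reduction of `(E_K)_F = E_F` at `w`
  obtain ⟨w, -, hw, -, -⟩ :=
    exists_primesAbove_mem_inertia_iff K F (adicCompletionPrime_mem_primesAbove K 𝔭)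
  have hpw : ((p : ℕ) : 𝓞 F) ∈ w.asIdeal := by
    have h1 : algebraMap (𝓞 K) (𝓞 F) (p : 𝓞 K) ∈ w.asIdeal := by
      rw [← Ideal.mem_comap]
      change (p : 𝓞 K) ∈ w.asIdeal.under (𝓞 K)
      rw [hw]; exact hp𝔭
    simpa only [map_natCast] using h1
  have hEF : (W.baseChange K).baseChange F = W.baseChange F := by
    simp only [WeierstrassCurve.baseChange, WeierstrassCurve.map_map]
    exact congrArg W.map (Subsingleton.elim _ _)
  have hgood : ((W.baseChange K).baseChange F).HasGoodReductionAt w := hgoodF w hw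
  have hss : ¬ ((W.baseChange K).baseChange F).HasUnitRootAt w := by
    rw [hEF]; exact hssF F w hpw (hEF ▸ hgood)
  -- (4) decomposition groups: `𝔔₀ = adicCompletionPrime F w`, `𝔓 = ι₁⁻¹ 𝔔₀`, `τ • 𝔓₀ = 𝔓`
  obtain ⟨𝔓, h𝔓, hD⟩ := exists_primesAbove_decompositionSubgroup_le_comap K F hw
    (adicCompletionPrime_mem_primesAbove (F : Type) w)
  obtain ⟨τ, hτ⟩ := HeightOneSpectrum.exists_smul_eq_of_mem_primesAbove_holds
    (adicCompletionPrime_mem_primesAbove K 𝔭) h𝔓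
  -- the embeddings and restrictions
  let ι₁ : AlgebraicClosure K →ₐ[K] AlgebraicClosure F := closureEmb (K := K) F
  let ι₂ : AlgebraicClosure F →ₐ[F] AlgebraicClosure (w.adicCompletion F) :=
    closureEmb (K := F) (w.adicCompletion F)
  have hres₁ : ∀ σ : absoluteGaloisGroup F, resGalOfEmb ι₁ σ = absGaloisRestrict K F σ := fun σ => by
    rw [show ι₁ = closureEmb (K := K) F from rfl, ← resGal_eq, WeierstrassCurve.resGal_eq_absGaloisRestrict]
  have hres₂ : ∀ γ : absoluteGaloisGroup (w.adicCompletion F),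
      resGalOfEmb ι₂ γ = absGaloisRestrict F (w.adicCompletion F) γ := fun γ => by
    rw [show ι₂ = closureEmb (K := F) (w.adicCompletion F) from rfl, ← resGal_eq,
      WeierstrassCurve.resGal_eq_absGaloisRestrict]
  -- `φ : Γ_{F_w} → Γ_K`, `φ γ = τ⁻¹ (γ|_{K̄}) τ ∈ D_𝔭`
  let δ : absoluteGaloisGroup (w.adicCompletion F) → absoluteGaloisGroup K :=
    fun γ => resGalOfEmb ι₁ (resGalOfEmb ι₂ γ)
  let φ : absoluteGaloisGroup (w.adicCompletion F) → absoluteGaloisGroup K := fun γ => τ⁻¹ * δ γ * τ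
  have hδ : ∀ γ, δ γ ∈ 𝔓.decompositionSubgroup (absoluteGaloisGroup K) := by
    intro γ
    have h2 : resGalOfEmb ι₂ γ ∈
        (adicCompletionPrime (F : Type) w).decompositionSubgroup (absoluteGaloisGroup F) := by
      rw [hres₂, decompositionSubgroup_adicCompletionPrime_eq_range]
      exact ⟨γ, rfl⟩
    have h1 := hD _ h2
    rwa [← hres₁] at h1
  have hφmem : ∀ γ, φ γ ∈ GreenbergSelmer.decomp 𝔭 := by
    intro γ
    change τ⁻¹ * δ γ * τ ∈ (absGaloisRestrict K (𝔭.adicCompletion K)).toMonoidHom.range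
    rw [← decompositionSubgroup_adicCompletionPrime_eq_range]
    have h1 := hδ γ
    rw [← hτ, Ideal.decompositionSubgroup_smul, Subgroup.mem_pointwise_smul_iff_inv_smul_mem,
      MulAut.smul_def, MulAut.conj_inv_apply] at h1
    exact h1
  -- the transport map `g = ι₂_* ∘ ι₁_* ∘ (τ • ·)` on `E(K̄)[p^∞]`
  let g : ↥((W.baseChange K).geomPrimaryTorsion p) →+
      localPoints ((W.baseChange K).baseChange F) (w.adicCompletion F) :=
    (pointsMapOfEmb ((W.baseChange K).baseChange F) ι₂).comp
      ((geomPointsMapOfEmb (W.baseChange K) ι₁).comp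
        ((DistribSMul.toAddMonoidHom (WeierstrassCurve.geomPoints (W.baseChange K)) τ).comp
          ((W.baseChange K).geomPrimaryTorsion p).subtype))
  have hg : ∀ c, g c = pointsMapOfEmb ((W.baseChange K).baseChange F) ι₂
      (geomPointsMapOfEmb (W.baseChange K) ι₁ (τ • (c : WeierstrassCurve.geomPoints (W.baseChange K)))) :=
    fun c => rfl
  have hg_inj : Function.Injective g := by
    intro a b hab
    rw [hg, hg] at hab
    exact Subtype.ext (MulAction.injective τ
      (geomPointsMapOfEmb_injective _ _ (pointsMapOfEmb_injective _ _ hab)))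
  have hφg : ∀ γ c, g (φ γ • c) = γ • g c := by
    intro γ c
    rw [hg, hg, primaryComponent.coe_smul, smul_smul]
    have hmul : τ * φ γ = resGalOfEmb ι₁ (resGalOfEmb ι₂ γ) * τ := by
      change τ * (τ⁻¹ * δ γ * τ) = δ γ * τ
      group
    rw [hmul, mul_smul, geomPointsMapOfEmb_smul, pointsMapOfEmb_smul]
  -- hypotheses on `N`
  have hstab : ∀ γ, ∀ c ∈ N, φ γ • c ∈ N := fun γ c hc => hNstab (φ γ) (hφmem γ) c hc
  have htors : ∀ c ∈ N, ∃ k : ℕ, p ^ k • c = 0 := by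
    intro c _
    obtain ⟨k, hk⟩ := (AddCommGroup.mem_primaryComponent.mp c.2)
    exact ⟨k, Subtype.ext (by rw [AddSubmonoidClass.coe_nsmul, hk]; rfl)⟩
  have hfin : {c : ↥((W.baseChange K).geomPrimaryTorsion p) | c ∈ N ∧ p • c = 0}.Finite := by
    haveI : Finite ↥(WeierstrassCurve.geomTorsion (W.baseChange K) (p : ℕ)) :=
      (W.baseChange K).finite_geomTorsion_nat hp.ne_zero
    have hT : ((WeierstrassCurve.geomTorsion (W.baseChange K) (p : ℕ) :
        AddSubgroup (WeierstrassCurve.geomPoints (W.baseChange K))) :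
        Set (WeierstrassCurve.geomPoints (W.baseChange K))).Finite := Set.toFinite _
    refine (hT.preimage Subtype.val_injective.injOn).subset ?_
    rintro c ⟨-, hc⟩
    rw [Set.mem_preimage, SetLike.mem_coe, WeierstrassCurve.mem_geomTorsion_iff, natCast_zsmul,
      ← AddSubmonoidClass.coe_nsmul, hc]
    rfl
  -- conclude by the local theorem at the good supersingular place `w`
  exact eq_bot_of_stable_of_injective p g hg_inj φ hφg
    (fun N₁ h1 h2 h3 h4 h5 =>
      eq_bot_of_stable_localPoints ((W.baseChange K).baseChange F) w hpw hgood hss N₁ h1 h2 h3 h4 h5)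
    N hstab htors hNdiv hfin hNcard

end Serre1967

end Literature.NumberTheory.EllipticCurves

end
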